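import Mathlib
import Summits.PneNP.PneNP.Theorems.OverlapGapAlgebraSolvableImpliesStableSectionEngine
import Summits.PneNP.PneNP.Theorems.OverlapGapAlgebraSolvableImpliesStableSectionAsymptotics

/-!
# Route OverlapGapAlgebra, crux `SolvableImpliesStableSection` (stmt-PneNP-2463), line `Sketch`:
# SMOOTH SECTIONS GIVE THE CONCLUSION — the engine stated in the crux's own language

`concl_of_smoothSection`: if, infinitely often in `n` (`m = ⌊α n⌋₊`), some map `g` and set `G` of instances are
such that `g` is `ν`-valid on `G`, `(k m)·#Gᶜ ≤ A·#instances`, and the one-slot Hamming jumps of `g` exceeding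
`η n` have total mass `≤ A·#instances·2n` ("a smooth section exists"), then for every `c > 0`, infinitely often,
some map realises the path event of `SolvableImpliesStableSection` (verbatim: `ν`-valid at all `k(mk)+1` splice
points of the Bresler–Huang path, consecutive moves `≤ η n`) on at least an `e^{-cn}` fraction of path tuples.
This is `engine_count` (Bresler–Huang walk lemma with validity folded into the bad edges) + `stub_asymptotics`;
it is the glue by which the crux reduces to the path-free statement "efficiently solvable ⇒ a smooth section
exists for all `η, ν > 0`" (the parked stub `stub_transfer` of `Lines/Sketch.lean`), and by which any future
line only has to produce smooth sections.
-/

set_option linter.dupNamespace false -- `Summit.PneNP.PneNP.…`: summit = sub-problem (D-0017)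

namespace Summit.PneNP.PneNP.Cruxes.SolvableImpliesStableSection.Sketch

open Finset
open scoped Classical

/-- **The engine in the crux's own language: smooth sections give the conclusion.** If, infinitely often in
`n` (with `m = ⌊α n⌋₊`), SOME map `g` and set `G` of instances satisfy (i) `g` violates at most `ν m` clauses on
`G`, (ii) `(k m)·#Gᶜ ≤ A·#instances`, (iii) the one-slot jumps of `g` larger than `η n` have total mass
`≤ A·#instances·2n`, then for every `c > 0`, infinitely often some map realises the path event of
`SolvableImpliesStableSection` / `NoStableSection` on at least an `e^{-cn}` fraction of path tuples. (This is the
composition `engine_count` + `stub_asymptotics`; the crux is exactly "efficient solvability ⇒ hypothesis of this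
theorem for all `η, ν`".) -/
theorem concl_of_smoothSection (k : ℕ) (hk : 1 ≤ k) (α η ν A : ℝ) (hα : 0 < α) (hη : 0 ≤ η) (hA : 0 < A)
    (hsm : ∃ᶠ n : ℕ in Filter.atTop, ∀ m : ℕ, m = ⌊α * n⌋₊ →
      ∃ g : (Fin m → Fin k → Fin n × Bool) → (Fin n → Bool),
      ∃ G : Finset (Fin m → Fin k → Fin n × Bool),
        (∀ Φ ∈ G, (((Finset.univ : Finset (Fin m)).filter fun i =>
            ∀ j, g Φ (Φ i j).1 ≠ (Φ i j).2).card : ℝ) ≤ ν * m) ∧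
        ((k * m : ℕ) : ℝ) * (Gᶜ.card : ℝ) ≤ A * Fintype.card (Fin m → Fin k → Fin n × Bool) ∧
        (∑ a : Fin m, ∑ b : Fin k,
            (((Finset.univ : Finset ((Fin m → Fin k → Fin n × Bool) × (Fin n × Bool))).filter
              fun p => η * n < hammingDist (g p.1)
                (g (Function.update p.1 a (Function.update (p.1 a) b p.2)))).card : ℝ))
          ≤ A * (Fintype.card (Fin m → Fin k → Fin n × Bool) * (2 * n)))
    (c : ℝ) (hc : 0 < c) :
    ∃ᶠ n : ℕ in Filter.atTop, ∀ m : ℕ, m = ⌊α * n⌋₊ →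
      ∃ g : (Fin m → Fin k → Fin n × Bool) → (Fin n → Bool),
        Real.exp (-(c * n)) * Fintype.card (Fin (k + 1) → Fin m → Fin k → Fin n × Bool) ≤
        ((Finset.univ.filter fun Ψ : Fin (k + 1) → Fin m → Fin k → Fin n × Bool =>
          let P : Fin k → ℕ → Fin m → Fin k → Fin n × Bool :=
            fun r q a b => if (a : ℕ) * k + b < q then Ψ r.succ a b else Ψ r.castSucc a b
          (∀ r : Fin k, ∀ q ≤ m * k, ((Finset.univ.filter fun i : Fin m =>
            ∀ j, g (P r q) (P r q i j).1 ≠ (P r q i j).2).card : ℝ) ≤ ν * m) ∧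
          ∀ r : Fin k, ∀ q < m * k,
            (hammingDist (g (P r q)) (g (P r (q + 1))) : ℝ) ≤ η * n).card : ℝ) := by
  have hev := stub_asymptotics k hk α A c hα hA hc
  refine ((hsm.and_eventually hev).and_eventually (Filter.eventually_ge_atTop 1)).mono ?_
  rintro n ⟨⟨hn, hasym⟩, hn1⟩ m hm
  obtain ⟨g, G, hval, hG, hjump⟩ := hn m hm
  refine ⟨g, ?_⟩
  have hE := engine_count k m n hn1 η A hη hA.le g G hG hjump
  subst hm
  have hpaths : (Fintype.card (Fin (k + 1) → Fin ⌊α * n⌋₊ → Fin k → Fin n × Bool) : ℝ) =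
      (2 * n) ^ (⌊α * n⌋₊ * k * (k + 1)) := by
    rw [eng_card_paths]; push_cast; ring
  have hmono : ((univ : Finset (Fin (k + 1) → Fin ⌊α * n⌋₊ → Fin k → Fin n × Bool)).filter fun Ψ =>
          (∀ r : Fin k, ∀ q ≤ ⌊α * n⌋₊ * k,
            (fun (a : Fin ⌊α * n⌋₊) (b : Fin k) =>
              if (a : ℕ) * k + b < q then Ψ r.succ a b else Ψ r.castSucc a b) ∈ G) ∧
          ∀ r : Fin k, ∀ q < ⌊α * n⌋₊ * k,
            (hammingDist
              (g fun (a : Fin ⌊α * n⌋₊) (b : Fin k) =>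
                if (a : ℕ) * k + b < q then Ψ r.succ a b else Ψ r.castSucc a b)
              (g fun (a : Fin ⌊α * n⌋₊) (b : Fin k) =>
                if (a : ℕ) * k + b < q + 1 then Ψ r.succ a b else Ψ r.castSucc a b) : ℝ)
              ≤ η * n).card ≤
      ((univ : Finset (Fin (k + 1) → Fin ⌊α * n⌋₊ → Fin k → Fin n × Bool)).filter fun Ψ =>
        let P : Fin k → ℕ → Fin ⌊α * n⌋₊ → Fin k → Fin n × Bool :=
          fun r q a b => if (a : ℕ) * k + b < q then Ψ r.succ a b else Ψ r.castSucc a b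
        (∀ r : Fin k, ∀ q ≤ ⌊α * n⌋₊ * k, (((Finset.univ : Finset (Fin ⌊α * n⌋₊)).filter fun i =>
          ∀ j, g (P r q) (P r q i j).1 ≠ (P r q i j).2).card : ℝ) ≤ ν * ⌊α * n⌋₊) ∧
        ∀ r : Fin k, ∀ q < ⌊α * n⌋₊ * k,
          (hammingDist (g (P r q)) (g (P r (q + 1))) : ℝ) ≤ η * n).card := by
    refine Finset.card_le_card fun Ψ hΨ => ?_
    simp only [Finset.mem_filter, Finset.mem_univ, true_and] at hΨ ⊢
    obtain ⟨hin, hjmp⟩ := hΨ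
    exact ⟨fun r q hq => hval _ (hin r q hq), fun r q hq => hjmp r q hq⟩
  have hmono' := (Nat.cast_le (α := ℝ)).2 hmono
  rw [hpaths]
  linarith [hasym, hE, hmono']

end Summit.PneNP.PneNP.Cruxes.SolvableImpliesStableSection.Sketch
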